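import Literature.Algebra.Homology.VanishingBaseChangeOfQuasiIso
import Mathlib.LinearAlgebra.Dimension.Finrank
import Mathlib.LinearAlgebra.Dimension.Basic
import HarnessLib

/-!
# Kernels of `d ⊗ κ` do not depend on the presentation of the test algebra `κ`
# ([MumfordAV1970] §5 Lemma 2, Cor. 3)

Layer `Literature/Algebra/Homology`, namespace `Literature.Algebra.Homology`.  THEOREMS ONLY (no definition, no named fact, no instance, no notation,
no `sorry`), Mathlib + ★ `VanishingBaseChangeOfQuasiIso` §6 (`rTensor_mem_ker_baseChange_iff`: `z ∈ ker(d ⊗ κ) ↔ (e ⊗ 1) z ∈ ker(d ⊗ κ')` for an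
`A`-linear isomorphism `e : κ ≅ κ'`).  Cell `hodgecm-mathlib` (D-0151), junction (alg-T) of the «H1-DIM-ANY-CHAR cut» (B-p04 memo v3 §2): the geometric
files (★ `Modules/GrothendieckComplexKernelRepr`, ★ `AbelianSchemes/PoincareKernelReprTests`) base-change the Grothendieck complex `K•` over `A = Γ(T, 𝒪)`
to the GEOMETRIC test algebras `Γ(Spec B, 𝒪)` (algebra structure `testAlgebra`, transition maps `testAlgHom`), while the algebraic entry point
(★ `BaseChangeComplexReprModuleResidueField.exists_residueField_surjective_exact_lcomp_baseChange_of_ker_tests`) speaks of the ABSTRACT test algebras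
`R ⧸ J`, `ResidueField R` (Mathlib algebra structures, transition maps `p.restrictScalars A`); the two differ by ring isomorphisms compatible with the
structure maps from `A` (`Scheme.ΓSpecIso`).  This file moves the two hypotheses (h1) (a rank) and (h2) (a lifting property) across such isomorphisms.

* §1 `nonempty_ker_baseChange_linearEquiv_of_algEquiv` — for an `A`-algebra isomorphism `e : κ ≃ₐ[A] κ'`: `ker(d ⊗ κ) ≃ₗ[A] ker(d ⊗ κ')` (restriction of
  `e ⊗ 1`), with `coe` formula; **`finrank_ker_baseChange_eq_of_ringEquiv`** — for a ring isomorphism `e : κ ≃+* κ'` with `e ∘ algebraMap = algebraMap`: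
  `finrank_κ ker(d ⊗ κ) = finrank_{κ'} ker(d ⊗ κ')`.
* §2 **`forall_ker_baseChange_lifts_iff_of_ringEquiv`** — for ring isomorphisms `e' : Γ' ≃+* B'`, `e₀ : Γ₀ ≃+* B₀` over `A` intertwining `A`-linear
  transition maps `t : Γ' → Γ₀`, `q : B' → B₀` (`e₀ ∘ t = q ∘ e'`): every `y ∈ ker(d ⊗ Γ₀)` is `(t ⊗ 1) x` for some `x ∈ ker(d ⊗ Γ')` iff every
  `y ∈ ker(d ⊗ B₀)` is `(q ⊗ 1) x` for some `x ∈ ker(d ⊗ B')`.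

HC_CM is proved only modulo the 7 printed citations until rung 0 closes; nothing here bears on a summit statement (count-neutral capital).

## References
* [MumfordAV1970] D. Mumford, *Abelian Varieties* (1970), §5 Lemma 2 (p. 49) and Cor. 3 (p. 53).
* [AtiyahMacdonald1969] M. F. Atiyah, I. G. Macdonald, *Introduction to Commutative Algebra* (1969), Prop. 2.14 and (2.19) (pp. 26–31).
-/

set_option autoImplicit false

universe u

open TensorProduct

noncomputable section

namespace Literature.Algebra.Homology

/-! ## §1 `ker(d ⊗ κ) ≅ ker(d ⊗ κ')` along an isomorphism of test algebras; ranks -/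

section Kernel

variable {A : Type u} [CommRing A] {κ κ' : Type u} [CommRing κ] [Algebra A κ] [CommRing κ'] [Algebra A κ']
  {M N : Type u} [AddCommGroup M] [Module A M] [AddCommGroup N] [Module A N] (d : M →ₗ[A] N)

/-- **`ker(d ⊗ κ) ≃ₗ[A] ker(d ⊗ κ')` along an `A`-algebra isomorphism `e : κ ≃ₐ[A] κ'`** (the restriction of `e ⊗ 1`, ★ `rTensor_mem_ker_baseChange_iff`),
together with the formula `↑(E z) = (e ⊗ 1) ↑z`. [cite: MumfordAV1970, §5 Cor. 3 (p. 53)] -/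
theorem nonempty_ker_baseChange_linearEquiv_of_algEquiv (e : κ ≃ₐ[A] κ') :
    ∃ E : (LinearMap.ker (d.baseChange κ)).restrictScalars A ≃ₗ[A] (LinearMap.ker (d.baseChange κ')).restrictScalars A,
      ∀ z, ((E z : (LinearMap.ker (d.baseChange κ')).restrictScalars A) : κ' ⊗[A] M) =
        LinearEquiv.rTensor M e.toLinearEquiv (z : κ ⊗[A] M) := by
  let F : κ ⊗[A] M ≃ₗ[A] κ' ⊗[A] M := LinearEquiv.rTensor M e.toLinearEquiv
  have hc : ((LinearMap.ker (d.baseChange κ')).restrictScalars A).comap (F : κ ⊗[A] M →ₗ[A] κ' ⊗[A] M) =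
      (LinearMap.ker (d.baseChange κ)).restrictScalars A := by
    ext z
    rw [Submodule.mem_comap, Submodule.restrictScalars_mem, Submodule.restrictScalars_mem]
    exact rTensor_mem_ker_baseChange_iff e.toLinearEquiv d z
  have hm : ((LinearMap.ker (d.baseChange κ)).restrictScalars A).map (F : κ ⊗[A] M →ₗ[A] κ' ⊗[A] M) =
      (LinearMap.ker (d.baseChange κ')).restrictScalars A := by
    rw [← hc]
    exact Submodule.map_comap_eq_of_surjective F.surjective _
  exact ⟨LinearEquiv.ofSubmodules F _ _ hm, fun z => rfl⟩

/-- `(e ⊗ 1)(r • w) = e(r) • (e ⊗ 1)(w)` for `r ∈ κ`: `e ⊗ 1` is semilinear over the ring isomorphism `e` for the left `κ`-structures.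
[cite: AtiyahMacdonald1969, Prop. 2.14 and (2.19) (pp. 26–31)] -/
theorem rTensor_algEquiv_smul (e : κ ≃ₐ[A] κ') (r : κ) (w : κ ⊗[A] M) :
    LinearEquiv.rTensor M e.toLinearEquiv (r • w) = e r • LinearEquiv.rTensor M e.toLinearEquiv w := by
  induction w using TensorProduct.induction_on with
  | zero => rw [smul_zero, map_zero, smul_zero]
  | tmul c m =>
      rw [TensorProduct.smul_tmul', LinearEquiv.rTensor_tmul, LinearEquiv.rTensor_tmul, TensorProduct.smul_tmul', smul_eq_mul, smul_eq_mul]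
      change e (r * c) ⊗ₜ[A] m = (e r * e c) ⊗ₜ[A] m
      rw [map_mul]
  | add x y hx hy => rw [smul_add, map_add, hx, hy, map_add, smul_add]

/-- **`finrank_κ ker(d ⊗ κ) = finrank_{κ'} ker(d ⊗ κ')` for a ring isomorphism `e : κ ≃+* κ'` compatible with the structure maps from `A`**
(e.g. `Scheme.ΓSpecIso`: `Γ(Spec k, 𝒪) ≅ k`; two presentations of a residue field).  Mathlib `rank_eq_of_equiv_equiv` for the additive isomorphism of §1,
semilinear over `e`. [cite: MumfordAV1970, §5 Cor. 3 (p. 53)] -/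
theorem finrank_ker_baseChange_eq_of_ringEquiv (e : κ ≃+* κ') (he : ∀ a, e (algebraMap A κ a) = algebraMap A κ' a) :
    Module.finrank κ (LinearMap.ker (d.baseChange κ)) = Module.finrank κ' (LinearMap.ker (d.baseChange κ')) := by
  let eA : κ ≃ₐ[A] κ' := AlgEquiv.ofRingEquiv (f := e) he
  obtain ⟨E, hE⟩ := nonempty_ker_baseChange_linearEquiv_of_algEquiv d eA
  have h := rank_eq_of_equiv_equiv (R := κ) (R' := κ') (M := LinearMap.ker (d.baseChange κ)) (M₁ := LinearMap.ker (d.baseChange κ'))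
    e (E.toAddEquiv : (LinearMap.ker (d.baseChange κ)).restrictScalars A ≃+ (LinearMap.ker (d.baseChange κ')).restrictScalars A)
    e.bijective (fun r z => by
      apply Subtype.ext
      change (((E (r • z) : (LinearMap.ker (d.baseChange κ')).restrictScalars A)) : κ' ⊗[A] M) =
        e r • ((E z : (LinearMap.ker (d.baseChange κ')).restrictScalars A) : κ' ⊗[A] M)
      rw [hE, hE]
      exact rTensor_algEquiv_smul eA r (z : κ ⊗[A] M))
  exact congrArg Cardinal.toNat h

end Kernel

/-! ## §2 The lifting property across a transition map does not depend on the presentation of the test algebras -/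

section Lifting

variable {A : Type u} [CommRing A] {Γ' Γ₀ B' B₀ : Type u} [CommRing Γ'] [Algebra A Γ'] [CommRing Γ₀] [Algebra A Γ₀]
  [CommRing B'] [Algebra A B'] [CommRing B₀] [Algebra A B₀]
  {M N : Type u} [AddCommGroup M] [Module A M] [AddCommGroup N] [Module A N] (d : M →ₗ[A] N)

/-- `(e₀ ⊗ 1) ∘ (t ⊗ 1) = (q ⊗ 1) ∘ (e' ⊗ 1)` when `e₀ ∘ t = q ∘ e'`. [cite: AtiyahMacdonald1969, Prop. 2.14 and (2.19) (pp. 26–31)] -/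
theorem rTensor_rTensor_eq_of_comm (e' : Γ' ≃ₐ[A] B') (e₀ : Γ₀ ≃ₐ[A] B₀) (t : Γ' →ₗ[A] Γ₀) (q : B' →ₗ[A] B₀)
    (htq : ∀ x, e₀ (t x) = q (e' x)) (x : Γ' ⊗[A] M) :
    LinearEquiv.rTensor M e₀.toLinearEquiv (t.rTensor M x) = q.rTensor M (LinearEquiv.rTensor M e'.toLinearEquiv x) := by
  induction x using TensorProduct.induction_on with
  | zero => rw [map_zero, map_zero, map_zero, map_zero]
  | tmul c m =>
      rw [LinearMap.rTensor_tmul, LinearEquiv.rTensor_tmul, LinearEquiv.rTensor_tmul, LinearMap.rTensor_tmul]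
      exact congrArg (fun b => b ⊗ₜ[A] m) (htq c)
  | add x y hx hy => rw [map_add, map_add, hx, hy, map_add, map_add]

/-- One direction of §2's equivalence (the other is the same statement for the inverse isomorphisms).
[cite: MumfordAV1970, §5 Lemma 2 (p. 49) and Cor. 3 (p. 53)] -/
theorem forall_ker_baseChange_lifts_of_algEquiv (e' : Γ' ≃ₐ[A] B') (e₀ : Γ₀ ≃ₐ[A] B₀) (t : Γ' →ₗ[A] Γ₀) (q : B' →ₗ[A] B₀)
    (htq : ∀ x, e₀ (t x) = q (e' x))
    (H : ∀ y : Γ₀ ⊗[A] M, d.baseChange Γ₀ y = 0 → ∃ x : Γ' ⊗[A] M, d.baseChange Γ' x = 0 ∧ t.rTensor M x = y) :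
    ∀ y : B₀ ⊗[A] M, d.baseChange B₀ y = 0 → ∃ x : B' ⊗[A] M, d.baseChange B' x = 0 ∧ q.rTensor M x = y := by
  intro y hy
  -- pull `y` back to `Γ₀ ⊗ M`
  have hy' : (LinearEquiv.rTensor M e₀.toLinearEquiv).symm y ∈ LinearMap.ker (d.baseChange Γ₀) := by
    rw [← rTensor_mem_ker_baseChange_iff e₀.toLinearEquiv d, LinearEquiv.apply_symm_apply]
    exact hy
  obtain ⟨x, hx0, hxy⟩ := H _ hy'
  refine ⟨LinearEquiv.rTensor M e'.toLinearEquiv x, ?_, ?_⟩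
  · have hx : x ∈ LinearMap.ker (d.baseChange Γ') := hx0
    rw [← rTensor_mem_ker_baseChange_iff e'.toLinearEquiv d] at hx
    exact hx
  · rw [← rTensor_rTensor_eq_of_comm e' e₀ t q htq, hxy, LinearEquiv.apply_symm_apply]

/-- **The lifting property across a transition map of test algebras is invariant under compatible ring isomorphisms of the test algebras.**
For ring isomorphisms `e' : Γ' ≃+* B'`, `e₀ : Γ₀ ≃+* B₀` compatible with the structure maps from `A` and with `A`-linear transition maps
`t : Γ' → Γ₀`, `q : B' → B₀` (`e₀ ∘ t = q ∘ e'`): `(∀ y ∈ ker(d ⊗ Γ₀), ∃ x ∈ ker(d ⊗ Γ'), (t ⊗ 1) x = y) ↔ (∀ y ∈ ker(d ⊗ B₀), ∃ x ∈ ker(d ⊗ B'), (q ⊗ 1) x = y)`.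
[cite: MumfordAV1970, §5 Lemma 2 (p. 49) and Cor. 3 (p. 53)] -/
theorem forall_ker_baseChange_lifts_iff_of_ringEquiv (e' : Γ' ≃+* B') (he' : ∀ a, e' (algebraMap A Γ' a) = algebraMap A B' a)
    (e₀ : Γ₀ ≃+* B₀) (he₀ : ∀ a, e₀ (algebraMap A Γ₀ a) = algebraMap A B₀ a) (t : Γ' →ₗ[A] Γ₀) (q : B' →ₗ[A] B₀)
    (htq : ∀ x, e₀ (t x) = q (e' x)) :
    (∀ y : Γ₀ ⊗[A] M, d.baseChange Γ₀ y = 0 → ∃ x : Γ' ⊗[A] M, d.baseChange Γ' x = 0 ∧ t.rTensor M x = y) ↔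
      (∀ y : B₀ ⊗[A] M, d.baseChange B₀ y = 0 → ∃ x : B' ⊗[A] M, d.baseChange B' x = 0 ∧ q.rTensor M x = y) := by
  let E' : Γ' ≃ₐ[A] B' := AlgEquiv.ofRingEquiv (f := e') he'
  let E₀ : Γ₀ ≃ₐ[A] B₀ := AlgEquiv.ofRingEquiv (f := e₀) he₀
  refine ⟨forall_ker_baseChange_lifts_of_algEquiv d E' E₀ t q htq, forall_ker_baseChange_lifts_of_algEquiv d E'.symm E₀.symm q t fun x => ?_⟩
  -- `e₀⁻¹ (q x) = t (e'⁻¹ x)`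
  apply E₀.injective
  change E₀ (E₀.symm (q x)) = e₀ (t (E'.symm x))
  rw [AlgEquiv.apply_symm_apply, htq]
  change q x = q (E' (E'.symm x))
  rw [AlgEquiv.apply_symm_apply]

end Lifting

end Literature.Algebra.Homology

end
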